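import Literature.AlgebraicGeometry.Motives.AbelianVarietyTorsionStalkQuotient
import Literature.AlgebraicGeometry.AbelianSchemes.AbelianLiftObstructionClass
import Literature.AlgebraicGeometry.GroupSchemes.BarsottiTateGroupBaseChange
import Literature.AlgebraicGeometry.GroupSchemes.BarsottiTateGroupFormallySmooth
import Literature.AlgebraicGeometry.GroupSchemes.SerreTateStabilisationTrivialKernel
import HarnessLib

/-!
# The special fibre of the unit-component tower of a Barsotti–Tate group: the layers `B[pⁿ] ×_A κ(A)` as kernel
# presentations of `[pⁿ]` on the closed fibre, and their stalks at the unit point (k-side of S1′-β)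

Topic `Literature/AlgebraicGeometry/GroupSchemes`; namespace `Literature.AlgebraicGeometry.GroupSchemes.BTGroup`.
THEOREMS ONLY (no definition, no named fact, no instance, no notation, no `sorry`).

Setting ([Tate1967] §2.2; the Serre–Tate special fibre): `A` Artinian local with residue field `k = κ(A)`, `J ≠ ⊤` an ideal,
`X₀ → Spec (A ⧸ J)` an abelian scheme, `B₀ = (B₀[pⁿ])ₙ` a Barsotti–Tate group over `Spec (A ⧸ J)` with a TORSION TOWER
`i₀ n : B₀[pⁿ] → X₀` (homomorphisms, cartesian against `[pⁿ]` and the unit section, compatible with the transitions — the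
three clauses of the cell's `IsTorsionTower`, taken here UNFOLDED as hypotheses), `B` a Barsotti–Tate group over `Spec A` with
`B₀ = B ×_A (A ⧸ J)` (★ `BTGroup.IsBaseChangeVia … c`). Write `X_κ := X₀ ×_{A⧸J} κ(A)` for the canonical closed fibre
(★ `closedFibre`), `𝒜` for its abelian-variety avatar, and `I n := [pⁿ]^♯ 𝔪_e · 𝒪_{𝒜,e}` (★ `AbelianVarietyTorsionStalkTower`).

* §1 the base-changed layer `B₀[pⁿ] ×_{A⧸J} κ(A) → X_κ` is a KERNEL PRESENTATION of `[pⁿ]` on `X_κ`; §2 it is also the base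
  change of `B[pⁿ]` along `Spec κ(A) → Spec A` (pasting with `c n`), unit points, transitions; §3 B8′ at that point:
  `τ n : 𝒪_{B₀[pⁿ]_κ, w} ≃+* 𝒪_{𝒜,e} ⧸ I n`, NATURAL in `n` and on constants; §4 `exists_theta_of_sigma` — assembly of the
  θ-datum of the special fibre of the unit-component tower (S1′-β) from an A-side stalk presentation `σ`.

References: [Tate1967] J. T. Tate, *p-divisible groups*, Proc. Conf. Local Fields (Driebergen 1966), §2.2, (2.4);
[GortzWedhorn2020] U. Görtz, T. Wedhorn, *Algebraic Geometry I*, 2nd ed., Section (4.7); [GortzWedhorn2023] Prop. 27.186.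
-/

noncomputable section

set_option backward.isDefEq.respectTransparency false

open CategoryTheory CategoryTheory.Limits AlgebraicGeometry MonoidalCategory CartesianMonoidalCategory IsLocalRing
open scoped MonObj CategoryTheory.Obj

namespace Literature.AlgebraicGeometry.GroupSchemes

namespace BTGroup

open Literature.AlgebraicGeometry.AbelianSchemes Literature.AlgebraicGeometry.AbelianSchemes.AbelianSchemeOver
open Literature.AlgebraicGeometry.Motives Literature.AlgebraicGeometry.Motives.AbelianVariety

variable {A : Type} [CommRing A] [IsLocalRing A] {J : Ideal A} (hJ : J ≠ ⊤) {p h₀ : ℕ}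
  (X₀ : AbelianSchemeOver (Spec (.of (A ⧸ J)))) (B₀ : BTGroup (Spec (.of (A ⧸ J))) p h₀) (i₀ : ∀ n, B₀.G n ⟶ X₀.X)

/-! ## §1 The base-changed layer is a kernel presentation of `[pⁿ]` on the closed fibre -/

/-- **`B₀[pⁿ] ×_{A⧸J} κ(A) → X_κ` is the kernel of `[pⁿ]` on the closed fibre**: the cartesian square
`B₀[pⁿ] →(i₀ n) X₀ →([pⁿ]) X₀ ←(e) Spec (A⧸J)` base-changes along `Spec κ(A) → Spec (A⧸J)` to the kernel square of
`[pⁿ]` on `X_κ = X₀ ×_{A⧸J} κ(A)` (★ `isPullback_map_of_isPullback_unit`; `[pⁿ] ×_{A⧸J} κ = [pⁿ]`, ★ `pullback_map_pow`).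
[cite: GortzWedhorn2020, Section (4.7) (pp. 107–108)] [cite: Tate1967, §2.2 (proof of Prop. 1)] -/
theorem isPullback_pullback_map_of_torsionSquare (n : ℕ)
    (hi₀sq : IsPullback (i₀ n) (toUnit (B₀.G n)) ((𝟙 X₀.X : X₀.X ⟶ X₀.X) ^ (p ^ n)) η[X₀.X]) :
    IsPullback ((Over.pullback (residueBaseMap hJ)).map (i₀ n)) (toUnit _)
      ((closedFibre hJ X₀).mulN (p ^ n)) η[(closedFibre hJ X₀).X] := by
  have h := isPullback_map_of_isPullback_unit (residueBaseMap hJ) hi₀sq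
  rw [pullback_map_pow, CategoryTheory.Functor.map_id] at h
  rw [mulN_def]
  exact h

/-! ## §2 … and the base change of `B[pⁿ]` along `Spec κ(A) → Spec A`; unit points -/

/-- `Spec κ(A) → Spec (A⧸J) → Spec A` is `Spec` of the residue map. [cite: GortzWedhorn2020, Section (4.7) (pp. 107–108)] -/
theorem residueBaseMap_comp_specMap_mk :
    residueBaseMap hJ ≫ Spec.map (CommRingCat.ofHom (Ideal.Quotient.mk J)) =
      Spec.map (CommRingCat.ofHom (IsLocalRing.residue A)) := by
  rw [residueBaseMap, ← Spec.map_comp, ← CommRingCat.ofHom_comp]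
  rfl

/-- **The special-fibre layer as a base change of `B[pⁿ]`**: pasting the pull-back square of `B₀[pⁿ] ×_{A⧸J} κ(A)` with the
cartesian square `c n : B₀[pⁿ] → B[pⁿ]` of ★ `IsBaseChangeVia` gives a cartesian square over `Spec κ(A) → Spec A`.
[cite: GortzWedhorn2020, Section (4.7) (pp. 107–108)] -/
theorem isPullback_fst_comp_of_isBaseChangeVia (B : BTGroup (Spec (.of A)) p h₀)
    {c : ∀ n, (B₀.G n).left ⟶ (B.G n).left}
    (hBc : B₀.IsBaseChangeVia B (Spec.map (CommRingCat.ofHom (Ideal.Quotient.mk J))) c) (n : ℕ) :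
    IsPullback (pullback.fst (B₀.G n).hom (residueBaseMap hJ) ≫ c n)
      ((Over.pullback (residueBaseMap hJ)).obj (B₀.G n)).hom (B.G n).hom
      (Spec.map (CommRingCat.ofHom (IsLocalRing.residue A))) := by
  obtain ⟨_, hsq, -, -⟩ := hBc.1 n
  have h1 : IsPullback (pullback.fst (B₀.G n).hom (residueBaseMap hJ))
      (pullback.snd (B₀.G n).hom (residueBaseMap hJ)) (B₀.G n).hom (residueBaseMap hJ) := IsPullback.of_hasPullback _ _
  have h2 := h1.paste_horiz hsq
  rw [residueBaseMap_comp_specMap_mk] at h2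
  exact h2

/-- **Unit points, I**: the base-changed kernel presentation `B₀[pⁿ] ×_{A⧸J} κ(A) → X_κ` is a homomorphism, so it sends the
unit point to the ORIGIN of the abelian variety `X_κ`. [cite: GortzWedhorn2020, Section (4.7) (pp. 107–108)] -/
theorem pullback_map_base_unit_eq_origin (n : ℕ) (hi₀hom : letI := B₀.grpObj n; IsMonHom (i₀ n)) :
    letI := B₀.grpObj n
    ((Over.pullback (residueBaseMap hJ)).map (i₀ n)).left.base
        (((η[(Over.pullback (residueBaseMap hJ)).obj (B₀.G n)]).left :
            Spec (.of (IsLocalRing.ResidueField A)) ⟶ _).base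
          (IsLocalRing.closedPoint (IsLocalRing.ResidueField A))) =
      origin (closedFibre hJ X₀).toAffine.toAbelianVariety := by
  letI := B₀.grpObj n
  haveI := hi₀hom
  have h1 : η[(Over.pullback (residueBaseMap hJ)).obj (B₀.G n)] ≫ (Over.pullback (residueBaseMap hJ)).map (i₀ n) =
      η[(closedFibre hJ X₀).X] := IsMonHom.one_hom _
  have h2 : ((η[(Over.pullback (residueBaseMap hJ)).obj (B₀.G n)]).left :
        Spec (.of (IsLocalRing.ResidueField A)) ⟶ _) ≫ ((Over.pullback (residueBaseMap hJ)).map (i₀ n)).left =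
      unitPt (closedFibre hJ X₀).toAffine.toAbelianVariety := by
    rw [← Over.comp_left, h1]
  rw [← Scheme.Hom.comp_apply, h2]
  rfl

/-- **Unit points, II**: under the pasted projection `B₀[pⁿ] ×_{A⧸J} κ(A) → B[pⁿ]` the unit point goes to the unit point of
`B[pⁿ]` (the unit sections are compatible with the cartesian squares, ★ `one_pullback_obj_left_comp_fst` and ★
`IsBaseChangeVia`; `Spec` of the residue map sends the point to the closed point). [cite: GortzWedhorn2020, Section (4.7) (pp. 107–108)] -/
theorem fst_comp_base_unit_eq_unit (B : BTGroup (Spec (.of A)) p h₀) {c : ∀ n, (B₀.G n).left ⟶ (B.G n).left}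
    (hBc : B₀.IsBaseChangeVia B (Spec.map (CommRingCat.ofHom (Ideal.Quotient.mk J))) c) (n : ℕ) :
    letI := B₀.grpObj n; letI := B.grpObj n
    (pullback.fst (B₀.G n).hom (residueBaseMap hJ) ≫ c n).base
        (((η[(Over.pullback (residueBaseMap hJ)).obj (B₀.G n)]).left :
            Spec (.of (IsLocalRing.ResidueField A)) ⟶ _).base
          (IsLocalRing.closedPoint (IsLocalRing.ResidueField A))) =
      ((η[B.G n]).left : Spec (.of A) ⟶ _).base (IsLocalRing.closedPoint A) := by
  letI := B₀.grpObj n; letI := B.grpObj n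
  obtain ⟨_, -, hunit, -⟩ := hBc.1 n
  have h1 : ((η[(Over.pullback (residueBaseMap hJ)).obj (B₀.G n)]).left :
        Spec (.of (IsLocalRing.ResidueField A)) ⟶ _) ≫
      (pullback.fst (B₀.G n).hom (residueBaseMap hJ) ≫ c n) =
      Spec.map (CommRingCat.ofHom (IsLocalRing.residue A)) ≫ ((η[B.G n]).left : Spec (.of A) ⟶ _) := by
    rw [← Category.assoc, one_pullback_obj_left_comp_fst, Category.assoc, hunit, ← Category.assoc,
      residueBaseMap_comp_specMap_mk]
  haveI : IsLocalHom (CommRingCat.ofHom (IsLocalRing.residue A)).hom :=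
    inferInstanceAs (IsLocalHom (IsLocalRing.residue A))
  have h4 : (Spec.map (CommRingCat.ofHom (IsLocalRing.residue A))).base
      (IsLocalRing.closedPoint (IsLocalRing.ResidueField A)) = IsLocalRing.closedPoint A :=
    Spec_closedPoint (f := CommRingCat.ofHom (IsLocalRing.residue A))
  calc (pullback.fst (B₀.G n).hom (residueBaseMap hJ) ≫ c n).base
        (((η[(Over.pullback (residueBaseMap hJ)).obj (B₀.G n)]).left :
            Spec (.of (IsLocalRing.ResidueField A)) ⟶ _).base (IsLocalRing.closedPoint (IsLocalRing.ResidueField A)))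
      = ((((η[(Over.pullback (residueBaseMap hJ)).obj (B₀.G n)]).left :
            Spec (.of (IsLocalRing.ResidueField A)) ⟶ _) ≫
          (pullback.fst (B₀.G n).hom (residueBaseMap hJ) ≫ c n)).base
          (IsLocalRing.closedPoint (IsLocalRing.ResidueField A))) := rfl
    _ = (Spec.map (CommRingCat.ofHom (IsLocalRing.residue A)) ≫ ((η[B.G n]).left : Spec (.of A) ⟶ _)).base
          (IsLocalRing.closedPoint (IsLocalRing.ResidueField A)) :=
          congrArg (fun f => f (IsLocalRing.closedPoint (IsLocalRing.ResidueField A))) h1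
    _ = ((η[B.G n]).left : Spec (.of A) ⟶ _).base
          ((Spec.map (CommRingCat.ofHom (IsLocalRing.residue A))).base
            (IsLocalRing.closedPoint (IsLocalRing.ResidueField A))) := rfl
    _ = ((η[B.G n]).left : Spec (.of A) ⟶ _).base (IsLocalRing.closedPoint A) :=
          congrArg (fun x : ↥(Spec (.of A)) => ((η[B.G n]).left : Spec (.of A) ⟶ _).base x) h4

/-- **Unit points, III**: the base-changed transitions send unit points to unit points (they are homomorphisms, ★
`isMonHom_transition`). [cite: Tate1967, (2.4)] -/
theorem pullback_map_transition_base_unit {n m : ℕ} (h : n ≤ m) :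
    letI := B₀.grpObj n; letI := B₀.grpObj m
    ((Over.pullback (residueBaseMap hJ)).map (B₀.transition h)).left.base
        (((η[(Over.pullback (residueBaseMap hJ)).obj (B₀.G n)]).left :
            Spec (.of (IsLocalRing.ResidueField A)) ⟶ _).base
          (IsLocalRing.closedPoint (IsLocalRing.ResidueField A))) =
      ((η[(Over.pullback (residueBaseMap hJ)).obj (B₀.G m)]).left :
          Spec (.of (IsLocalRing.ResidueField A)) ⟶ _).base
        (IsLocalRing.closedPoint (IsLocalRing.ResidueField A)) := by
  letI := B₀.grpObj n; letI := B₀.grpObj m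
  haveI : IsMonHom (B₀.transition h) := B₀.isMonHom_transition h
  have h1 : η[(Over.pullback (residueBaseMap hJ)).obj (B₀.G n)] ≫
      (Over.pullback (residueBaseMap hJ)).map (B₀.transition h) =
      η[(Over.pullback (residueBaseMap hJ)).obj (B₀.G m)] := IsMonHom.one_hom _
  have h2 : ((η[(Over.pullback (residueBaseMap hJ)).obj (B₀.G n)]).left :
        Spec (.of (IsLocalRing.ResidueField A)) ⟶ _) ≫
      ((Over.pullback (residueBaseMap hJ)).map (B₀.transition h)).left =
      ((η[(Over.pullback (residueBaseMap hJ)).obj (B₀.G m)]).left : Spec (.of (IsLocalRing.ResidueField A)) ⟶ _) := by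
    rw [← Over.comp_left, h1]
  rw [← Scheme.Hom.comp_apply, h2]

/-- The base-changed transitions lie OVER the transitions of `B` through the pasted projections (★
`IsBaseChangeVia.transition_left_comp`). [cite: Tate1967, (2.4)] -/
theorem pullback_map_transition_left_comp_fst_comp (B : BTGroup (Spec (.of A)) p h₀)
    {c : ∀ n, (B₀.G n).left ⟶ (B.G n).left}
    (hBc : B₀.IsBaseChangeVia B (Spec.map (CommRingCat.ofHom (Ideal.Quotient.mk J))) c) {n m : ℕ} (h : n ≤ m) :
    ((Over.pullback (residueBaseMap hJ)).map (B₀.transition h)).left ≫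
        (pullback.fst (B₀.G m).hom (residueBaseMap hJ) ≫ c m) =
      (pullback.fst (B₀.G n).hom (residueBaseMap hJ) ≫ c n) ≫ (B.transition h).left := by
  have h1 : ((Over.pullback (residueBaseMap hJ)).map (B₀.transition h)).left ≫
      pullback.fst (B₀.G m).hom (residueBaseMap hJ) =
      pullback.fst (B₀.G n).hom (residueBaseMap hJ) ≫ (B₀.transition h).left := pullback.lift_fst _ _ _
  rw [← Category.assoc, h1, Category.assoc, hBc.transition_left_comp h, Category.assoc]

/-- The base-changed transitions lie over `Spec κ(A)`. [cite: GortzWedhorn2020, Section (4.7) (pp. 107–108)] -/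
theorem pullback_map_transition_left_comp_hom {n m : ℕ} (h : n ≤ m) :
    ((Over.pullback (residueBaseMap hJ)).map (B₀.transition h)).left ≫
        ((Over.pullback (residueBaseMap hJ)).obj (B₀.G m)).hom =
      ((Over.pullback (residueBaseMap hJ)).obj (B₀.G n)).hom :=
  Over.w _

/-- The base-changed torsion tower: `(B₀.transition h) ×_{A⧸J} κ ≫ (i₀ m) ×_{A⧸J} κ = (i₀ n) ×_{A⧸J} κ` (★
`transition_comp_family`). [cite: Tate1967, §2 (2.1)] -/
theorem pullback_map_transition_comp_pullback_map {n m : ℕ} (h : n ≤ m)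
    (hi₀incl : ∀ n, B₀.incl n ≫ i₀ (n + 1) = i₀ n) :
    (Over.pullback (residueBaseMap hJ)).map (B₀.transition h) ≫ (Over.pullback (residueBaseMap hJ)).map (i₀ m) =
      (Over.pullback (residueBaseMap hJ)).map (i₀ n) := by
  rw [← Functor.map_comp, B₀.transition_comp_family i₀ hi₀incl h]

/-- Generic stalk bookkeeping: for `f = u ≫ g` and a point `x` with `f x = z = g (u x)`, pulling a germ at `z` back along
`g` then `u` is pulling it back along `f` (Mathlib `Scheme.Hom.stalkMap_comp`, written with the point transports
`stalkCongr` that the kernel-presentation stalk maps carry). [cite: GortzWedhorn2020, Section (4.7) (pp. 107–108)] -/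
theorem stalkMap_stalkMap_stalkCongr_apply {X Y Z : Scheme.{0}} (u : X ⟶ Y) (g : Y ⟶ Z) (f : X ⟶ Z) (hf : u ≫ g = f)
    (x : ↥X) {z : ↥Z} (hx : f.base x = z) (hy : g.base (u.base x) = z) (a : ↥(Z.presheaf.stalk z)) :
    (u.stalkMap x).hom ((g.stalkMap (u.base x)).hom ((Z.presheaf.stalkCongr (.of_eq hy)).inv.hom a)) =
      (f.stalkMap x).hom ((Z.presheaf.stalkCongr (.of_eq hx)).inv.hom a) := by
  subst hf; subst hx
  obtain ⟨U, hzU, s, rfl⟩ := Z.presheaf.exists_germ_eq a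
  simp only [TopCat.Presheaf.stalkCongr_inv, TopCat.Presheaf.germ_stalkSpecializes_apply,
    Scheme.Hom.germ_stalkMap_apply, Scheme.Hom.comp_app, CommRingCat.comp_apply]
  rfl

/-! ## §3 The stalk of the special-fibre layer at the unit point is `𝒪_{𝒜,e} ⧸ [pⁿ]^♯ 𝔪_e · 𝒪_{𝒜,e}` (B8′), naturally -/

/-- **B8′ at the special-fibre layer, one layer**: for `w ∈ B₀[pⁿ] ×_{A⧸J} κ(A)` over the origin of `X_κ`, the stalk map of
the kernel presentation is surjective with kernel `I n`, whence a ring isomorphism `𝒪_{B₀[pⁿ]_κ, w} ≃+* 𝒪_{𝒜,e} ⧸ I n` through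
which that stalk map becomes the quotient map (★ `exists_ringEquiv_stalk_quotient_of_isPullback_mulN`), and which sends the
germ of a structure constant `c ∈ κ(A)` to the class of `stalkOriginAlgebraMap c` (★ `stalkMap_stalkOriginAlgebraMap_of_over`).
[cite: Tate1967, §2.2 (proof of Prop. 1)] [cite: GortzWedhorn2023, Prop. 27.186 (p. 674)] -/
theorem exists_ringEquiv_stalk_specialFibre_layer (n : ℕ)
    (hi₀sq : IsPullback (i₀ n) (toUnit (B₀.G n)) ((𝟙 X₀.X : X₀.X ⟶ X₀.X) ^ (p ^ n)) η[X₀.X])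
    (w : ↥((Over.pullback (residueBaseMap hJ)).obj (B₀.G n)).left)
    (hw : ((Over.pullback (residueBaseMap hJ)).map (i₀ n)).left.base w =
      origin (closedFibre hJ X₀).toAffine.toAbelianVariety) :
    ∃ τ : ↥(((Over.pullback (residueBaseMap hJ)).obj (B₀.G n)).left.presheaf.stalk w) ≃+*
        ↥(stalkOrigin (closedFibre hJ X₀).toAffine.toAbelianVariety) ⧸
          (maximalIdeal (stalkOrigin (closedFibre hJ X₀).toAffine.toAbelianVariety)).map
            (stalkMapEnd (closedFibre hJ X₀).toAffine.toAbelianVariety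
              (((p ^ n : ℕ) : ℤ) • 𝟙 (closedFibre hJ X₀).toAffine.toAbelianVariety)).hom,
      (∀ x, τ ((((closedFibre hJ X₀).X.left.presheaf.stalkCongr (.of_eq hw)).inv ≫
          ((Over.pullback (residueBaseMap hJ)).map (i₀ n)).left.stalkMap w) x) = Ideal.Quotient.mk _ x) ∧
      (∀ c : IsLocalRing.ResidueField A,
        τ ((((Over.pullback (residueBaseMap hJ)).obj (B₀.G n)).left.presheaf.germ ⊤ w trivial)
            ((((Over.pullback (residueBaseMap hJ)).obj (B₀.G n)).hom.appTop)
              ((Scheme.ΓSpecIso (.of (IsLocalRing.ResidueField A))).inv c))) =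
          Ideal.Quotient.mk _ (stalkOriginAlgebraMap (closedFibre hJ X₀).toAffine.toAbelianVariety c)) := by
  have H := isPullback_pullback_map_of_torsionSquare hJ X₀ B₀ i₀ n hi₀sq
  obtain ⟨τ, hτ⟩ := Motives.AbelianSchemeOver.exists_ringEquiv_stalk_quotient_of_isPullback_mulN
    (𝒜 := closedFibre hJ X₀) H w hw
  refine ⟨τ, hτ, fun c => ?_⟩
  rw [← Motives.AbelianSchemeOver.stalkMap_stalkOriginAlgebraMap_of_over (𝒜 := closedFibre hJ X₀) w hw c]
  exact hτ _

/-- **B8′ at the special-fibre layers, NATURALITY in the layer**: for `n ≤ m`, points `wₙ ↦ wₘ` under the base-changed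
transition and over the origin, and the two ring isomorphisms of `exists_ringEquiv_stalk_specialFibre_layer`, pulling a germ
back along the transition `B₀[pⁿ]_κ → B₀[pᵐ]_κ` corresponds to the quotient map `𝒪_{𝒜,e} ⧸ I m → 𝒪_{𝒜,e} ⧸ I n` (the
transition followed by the kernel presentation of layer `m` IS the kernel presentation of layer `n`, ★ `transition_comp_family`).
[cite: Tate1967, §2.2 (proof of Prop. 1)] [cite: GortzWedhorn2023, Prop. 27.186 (p. 674)] -/
theorem ringEquiv_stalk_specialFibre_layer_naturality (hpk : (p : IsLocalRing.ResidueField A) = 0) {n m : ℕ} (h : n ≤ m)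
    (hi₀sq : IsPullback (i₀ m) (toUnit (B₀.G m)) ((𝟙 X₀.X : X₀.X ⟶ X₀.X) ^ (p ^ m)) η[X₀.X])
    (hi₀incl : ∀ n, B₀.incl n ≫ i₀ (n + 1) = i₀ n)
    (wn : ↥((Over.pullback (residueBaseMap hJ)).obj (B₀.G n)).left)
    (wm : ↥((Over.pullback (residueBaseMap hJ)).obj (B₀.G m)).left)
    (huw : ((Over.pullback (residueBaseMap hJ)).map (B₀.transition h)).left.base wn = wm)
    (hwn : ((Over.pullback (residueBaseMap hJ)).map (i₀ n)).left.base wn =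
      origin (closedFibre hJ X₀).toAffine.toAbelianVariety)
    (hwm : ((Over.pullback (residueBaseMap hJ)).map (i₀ m)).left.base wm =
      origin (closedFibre hJ X₀).toAffine.toAbelianVariety)
    (τn : ↥(((Over.pullback (residueBaseMap hJ)).obj (B₀.G n)).left.presheaf.stalk wn) ≃+*
        ↥(stalkOrigin (closedFibre hJ X₀).toAffine.toAbelianVariety) ⧸
          (maximalIdeal (stalkOrigin (closedFibre hJ X₀).toAffine.toAbelianVariety)).map
            (stalkMapEnd (closedFibre hJ X₀).toAffine.toAbelianVariety
              (((p ^ n : ℕ) : ℤ) • 𝟙 (closedFibre hJ X₀).toAffine.toAbelianVariety)).hom)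
    (hτn : ∀ x, τn ((((closedFibre hJ X₀).X.left.presheaf.stalkCongr (.of_eq hwn)).inv ≫
          ((Over.pullback (residueBaseMap hJ)).map (i₀ n)).left.stalkMap wn) x) = Ideal.Quotient.mk _ x)
    (τm : ↥(((Over.pullback (residueBaseMap hJ)).obj (B₀.G m)).left.presheaf.stalk wm) ≃+*
        ↥(stalkOrigin (closedFibre hJ X₀).toAffine.toAbelianVariety) ⧸
          (maximalIdeal (stalkOrigin (closedFibre hJ X₀).toAffine.toAbelianVariety)).map
            (stalkMapEnd (closedFibre hJ X₀).toAffine.toAbelianVariety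
              (((p ^ m : ℕ) : ℤ) • 𝟙 (closedFibre hJ X₀).toAffine.toAbelianVariety)).hom)
    (hτm : ∀ x, τm ((((closedFibre hJ X₀).X.left.presheaf.stalkCongr (.of_eq hwm)).inv ≫
          ((Over.pullback (residueBaseMap hJ)).map (i₀ m)).left.stalkMap wm) x) = Ideal.Quotient.mk _ x)
    (z : ↥(((Over.pullback (residueBaseMap hJ)).obj (B₀.G m)).left.presheaf.stalk wm)) :
    τn ((((Over.pullback (residueBaseMap hJ)).map (B₀.transition h)).left.stalkMap wn).hom
        ((((Over.pullback (residueBaseMap hJ)).obj (B₀.G m)).left.presheaf.stalkCongr (.of_eq huw)).inv.hom z)) =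
      Ideal.Quotient.factor ((closedFibre hJ X₀).toAffine.toAbelianVariety.antitone_torsionStalkIdeal hpk h) (τm z) := by
  have Hm := isPullback_pullback_map_of_torsionSquare hJ X₀ B₀ i₀ m hi₀sq
  obtain ⟨y, rfl⟩ := Motives.AbelianSchemeOver.surjective_stalkMap_of_isPullback_mulN (𝒜 := closedFibre hJ X₀) Hm wm hwm z
  subst huw
  have hf : ((Over.pullback (residueBaseMap hJ)).map (B₀.transition h)).left ≫
      ((Over.pullback (residueBaseMap hJ)).map (i₀ m)).left = ((Over.pullback (residueBaseMap hJ)).map (i₀ n)).left := by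
    rw [← Over.comp_left, pullback_map_transition_comp_pullback_map hJ X₀ B₀ i₀ h hi₀incl]
  have key : (((Over.pullback (residueBaseMap hJ)).map (B₀.transition h)).left.stalkMap wn).hom
      ((((Over.pullback (residueBaseMap hJ)).map (i₀ m)).left.stalkMap _).hom
        (((closedFibre hJ X₀).X.left.presheaf.stalkCongr (.of_eq hwm)).inv.hom y)) =
      (((Over.pullback (residueBaseMap hJ)).map (i₀ n)).left.stalkMap wn).hom
        (((closedFibre hJ X₀).X.left.presheaf.stalkCongr (.of_eq hwn)).inv.hom y) :=
    stalkMap_stalkMap_stalkCongr_apply _ _ _ hf wn hwn hwm y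
  have hτn' := hτn y
  have hτm' := hτm y
  simp only [CommRingCat.hom_comp, RingHom.coe_comp, Function.comp_apply] at hτn' hτm' ⊢
  simp only [TopCat.Presheaf.stalkCongr_inv, TopCat.Presheaf.stalkSpecializes_refl, CommRingCat.hom_id,
    RingHom.id_apply] at key hτn' hτm' ⊢
  have e1 := congrArg τn key
  have e3 := congrArg
    (fun t => Ideal.Quotient.factor ((closedFibre hJ X₀).toAffine.toAbelianVariety.antitone_torsionStalkIdeal hpk h) t)
    hτm'
  have e4 := Ideal.Quotient.factor_mk
    ((closedFibre hJ X₀).toAffine.toAbelianVariety.antitone_torsionStalkIdeal hpk h) y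
  exact (e1.trans hτn').trans (e3.trans e4).symm

/-- **The τ-TOWER of the special fibre**: compatible ring isomorphisms `τ n : 𝒪_{B₀[pⁿ]_κ, wₙ} ≃+* 𝒪_{𝒜,e} ⧸ I n` for points
`wₙ` over the origin carried to each other by the transitions — through which the kernel-presentation stalk maps become the
quotient maps, NATURAL in `n` (transitions ↦ `Ideal.Quotient.factor`), and sending the germs of the structure constants
`c ∈ κ(A)` to `stalkOriginAlgebraMap c`. [cite: Tate1967, §2.2 (proof of Prop. 1)] [cite: GortzWedhorn2023, Prop. 27.186 (p. 674)] -/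
theorem exists_ringEquiv_stalk_specialFibre_tower (hpk : (p : IsLocalRing.ResidueField A) = 0)
    (hi₀sq : ∀ n, IsPullback (i₀ n) (toUnit (B₀.G n)) ((𝟙 X₀.X : X₀.X ⟶ X₀.X) ^ (p ^ n)) η[X₀.X])
    (hi₀incl : ∀ n, B₀.incl n ≫ i₀ (n + 1) = i₀ n)
    (w : ∀ n, ↥((Over.pullback (residueBaseMap hJ)).obj (B₀.G n)).left)
    (hw : ∀ n, ((Over.pullback (residueBaseMap hJ)).map (i₀ n)).left.base (w n) =
      origin (closedFibre hJ X₀).toAffine.toAbelianVariety)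
    (huw : ∀ (n m : ℕ) (h : n ≤ m), ((Over.pullback (residueBaseMap hJ)).map (B₀.transition h)).left.base (w n) = w m) :
    ∃ τ : ∀ n, ↥(((Over.pullback (residueBaseMap hJ)).obj (B₀.G n)).left.presheaf.stalk (w n)) ≃+*
        ↥(stalkOrigin (closedFibre hJ X₀).toAffine.toAbelianVariety) ⧸
          (maximalIdeal (stalkOrigin (closedFibre hJ X₀).toAffine.toAbelianVariety)).map
            (stalkMapEnd (closedFibre hJ X₀).toAffine.toAbelianVariety
              (((p ^ n : ℕ) : ℤ) • 𝟙 (closedFibre hJ X₀).toAffine.toAbelianVariety)).hom,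
      (∀ n x, τ n ((((closedFibre hJ X₀).X.left.presheaf.stalkCongr (.of_eq (hw n))).inv ≫
          ((Over.pullback (residueBaseMap hJ)).map (i₀ n)).left.stalkMap (w n)) x) = Ideal.Quotient.mk _ x) ∧
      (∀ (n m : ℕ) (h : n ≤ m) (z : ↥(((Over.pullback (residueBaseMap hJ)).obj (B₀.G m)).left.presheaf.stalk (w m))),
        τ n ((((Over.pullback (residueBaseMap hJ)).map (B₀.transition h)).left.stalkMap (w n)).hom
          ((((Over.pullback (residueBaseMap hJ)).obj (B₀.G m)).left.presheaf.stalkCongr (.of_eq (huw n m h))).inv.hom z)) =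
          Ideal.Quotient.factor ((closedFibre hJ X₀).toAffine.toAbelianVariety.antitone_torsionStalkIdeal hpk h) (τ m z)) ∧
      (∀ n (c : IsLocalRing.ResidueField A),
        τ n ((((Over.pullback (residueBaseMap hJ)).obj (B₀.G n)).left.presheaf.germ ⊤ (w n) trivial)
            ((((Over.pullback (residueBaseMap hJ)).obj (B₀.G n)).hom.appTop)
              ((Scheme.ΓSpecIso (.of (IsLocalRing.ResidueField A))).inv c))) =
          Ideal.Quotient.mk _ (stalkOriginAlgebraMap (closedFibre hJ X₀).toAffine.toAbelianVariety c)) := by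
  choose τ hτ hτc using fun n => exists_ringEquiv_stalk_specialFibre_layer hJ X₀ B₀ i₀ n (hi₀sq n) (w n) (hw n)
  exact ⟨τ, hτ, fun n m h z => ringEquiv_stalk_specialFibre_layer_naturality hJ X₀ B₀ i₀ hpk h (hi₀sq m) hi₀incl
    (w n) (w m) (huw n m h) (hw n) (hw m) (τ n) (hτ n) (τ m) (hτ m) z, hτc⟩

/-! ## §4 Assembly: from the A-side stalk presentation `σ` of `Γ(G₀ n) ⧸ 𝔪·Γ(G₀ n)` to the θ-datum of the special fibre -/

/-- **ASSEMBLY OF THE θ-DATUM FROM THE TWO STALK PRESENTATIONS.** Let `σ n : Γ(G₀ n) ⧸ 𝔪·Γ(G₀ n) ≃+* 𝒪_{B₀[pⁿ]_κ, eₙ}` be ring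
isomorphisms onto the stalks of the special-fibre layers `B₀[pⁿ] ×_{A⧸J} κ(A)` at their unit points, compatible with the
sub-tower maps `incl₀` ∕ the base-changed transitions and with the structure maps (the shape of the σ-interface of the
unit-component special-fibre stalk organ, for ANY affine `A`-schemes `G₀ n` with maps `incl₀`). Composing with the τ-tower
(`exists_ringEquiv_stalk_specialFibre_tower`) gives `θ n : Γ(G₀ n) ⧸ 𝔪·Γ(G₀ n) ≃+* 𝒪_{𝒜,e} ⧸ I n`, natural in `n`
(`incl₀` ↦ `Ideal.Quotient.factor`) and sending the structure constant of `a ∈ A` to `stalkOriginAlgebraMap (residue a)` —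
the θ-datum `θ hθρ hθc` of ★ `PowerSeriesTower.exists_specialFibre_transport` at the special fibre.
[cite: Tate1967, §2.2 (proof of Prop. 1)] [cite: GortzWedhorn2023, Prop. 27.186 (p. 674)] -/
theorem exists_theta_of_sigma (hpk : (p : IsLocalRing.ResidueField A) = 0)
    (hi₀hom : ∀ n, letI := B₀.grpObj n; IsMonHom (i₀ n))
    (hi₀sq : ∀ n, IsPullback (i₀ n) (toUnit (B₀.G n)) ((𝟙 X₀.X : X₀.X ⟶ X₀.X) ^ (p ^ n)) η[X₀.X])
    (hi₀incl : ∀ n, B₀.incl n ≫ i₀ (n + 1) = i₀ n)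
    (G₀ : ℕ → Over (Spec (.of A))) (incl₀ : ∀ ⦃n m : ℕ⦄, n ≤ m → ((G₀ n).left ⟶ (G₀ m).left))
    (hσ : letI : ∀ n, Algebra A Γ((G₀ n).left, ⊤) :=
        fun n => (((G₀ n).hom.appTop).hom.comp (Scheme.ΓSpecIso (.of A)).inv.hom).toAlgebra
      ∃ σ : ∀ n, (Γ((G₀ n).left, ⊤) ⧸ (IsLocalRing.maximalIdeal A).map (algebraMap A Γ((G₀ n).left, ⊤))) ≃+*
          ↥(((Over.pullback (residueBaseMap hJ)).obj (B₀.G n)).left.presheaf.stalk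
            (letI := B₀.grpObj n
             (((η[(Over.pullback (residueBaseMap hJ)).obj (B₀.G n)]).left :
                Spec (.of (IsLocalRing.ResidueField A)) ⟶ _).base
              (IsLocalRing.closedPoint (IsLocalRing.ResidueField A))))),
        (∀ (n m : ℕ) (h : n ≤ m) (x : Γ((G₀ m).left, ⊤)),
          σ n (Ideal.Quotient.mk _ (((incl₀ h).appTop).hom x)) =
            ((((Over.pullback (residueBaseMap hJ)).map (B₀.transition h)).left.stalkMap _).hom
              (((((Over.pullback (residueBaseMap hJ)).obj (B₀.G m)).left.presheaf.stalkCongr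
                (.of_eq (pullback_map_transition_base_unit hJ B₀ h))).inv.hom (σ m (Ideal.Quotient.mk _ x)))))) ∧
        (∀ (n : ℕ) (a : A),
          σ n (Ideal.Quotient.mk _ (((G₀ n).hom.appTop).hom ((Scheme.ΓSpecIso (.of A)).inv.hom a))) =
            ((((Over.pullback (residueBaseMap hJ)).obj (B₀.G n)).left.presheaf.germ ⊤ _ trivial).hom
              ((((Over.pullback (residueBaseMap hJ)).obj (B₀.G n)).hom.appTop).hom
                ((Scheme.ΓSpecIso (.of (IsLocalRing.ResidueField A))).inv.hom (IsLocalRing.residue A a)))))) :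
    letI : ∀ n, Algebra A Γ((G₀ n).left, ⊤) :=
      fun n => (((G₀ n).hom.appTop).hom.comp (Scheme.ΓSpecIso (.of A)).inv.hom).toAlgebra
    ∃ θ : ∀ n, (Γ((G₀ n).left, ⊤) ⧸ (IsLocalRing.maximalIdeal A).map (algebraMap A Γ((G₀ n).left, ⊤))) ≃+*
        ↥(stalkOrigin (closedFibre hJ X₀).toAffine.toAbelianVariety) ⧸
          (maximalIdeal (stalkOrigin (closedFibre hJ X₀).toAffine.toAbelianVariety)).map
            (stalkMapEnd (closedFibre hJ X₀).toAffine.toAbelianVariety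
              (((p ^ n : ℕ) : ℤ) • 𝟙 (closedFibre hJ X₀).toAffine.toAbelianVariety)).hom,
      (∀ ⦃n m : ℕ⦄ (h : n ≤ m) (x : Γ((G₀ m).left, ⊤)),
        θ n (Ideal.Quotient.mk _ (((incl₀ h).appTop).hom x)) =
          Ideal.Quotient.factor ((closedFibre hJ X₀).toAffine.toAbelianVariety.antitone_torsionStalkIdeal hpk h)
            (θ m (Ideal.Quotient.mk _ x))) ∧
      (∀ (n : ℕ) (a : A),
        θ n (Ideal.Quotient.mk _ (((G₀ n).hom.appTop).hom ((Scheme.ΓSpecIso (.of A)).inv.hom a))) =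
          Ideal.Quotient.mk _
            (stalkOriginAlgebraMap (closedFibre hJ X₀).toAffine.toAbelianVariety (IsLocalRing.residue A a))) := by
  letI : ∀ n, Algebra A Γ((G₀ n).left, ⊤) :=
    fun n => (((G₀ n).hom.appTop).hom.comp (Scheme.ΓSpecIso (.of A)).inv.hom).toAlgebra
  obtain ⟨σ, hσnat, hσc⟩ := hσ
  obtain ⟨τ, -, hτnat, hτc⟩ := exists_ringEquiv_stalk_specialFibre_tower hJ X₀ B₀ i₀ hpk hi₀sq hi₀incl
    (fun n => letI := B₀.grpObj n
      (((η[(Over.pullback (residueBaseMap hJ)).obj (B₀.G n)]).left : Spec (.of (IsLocalRing.ResidueField A)) ⟶ _).base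
        (IsLocalRing.closedPoint (IsLocalRing.ResidueField A))))
    (fun n => pullback_map_base_unit_eq_origin hJ X₀ B₀ i₀ n (hi₀hom n))
    (fun n m h => pullback_map_transition_base_unit hJ B₀ h)
  refine ⟨fun n => (σ n).trans (τ n), fun n m h x => ?_, fun n a => ?_⟩
  · rw [RingEquiv.trans_apply, RingEquiv.trans_apply, hσnat n m h x]
    exact hτnat n m h _
  · rw [RingEquiv.trans_apply, hσc n a]
    exact hτc n (IsLocalRing.residue A a)

end BTGroup

end Literature.AlgebraicGeometry.GroupSchemes

end
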